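import Summits.CriticalPhenomena.CardyFormulaZ2.Theorems.CardySusyWardParafermionFamiliesToSLESixAnchoredWallFluxTouch

/-!
# The strip anchor (stub S5 of line `strip-anchored-vertex-normalisation`, crux stmt-CriticalPhenomena-10814), III:
# TouchPhase, toggle step — the winding of the exploration at a dart is invariant under toggling one edge

Helper file for `stub_anchoredWallFlux`. Admissible data `E` with hole-free inner faces; configurations `ω, ω'`
whose completed configurations `β, β'` differ exactly at the edge `cTgt p`; cut orbits `orb, orb'` of the start
corner, exit times `N, N'`. A corner that is a dart of BOTH exploration paths, `c = orb i = orb' i'` (`i < N`,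
`i' < N'`), has the same turn count (winding) in both — the three cases on the two corners `p, p₂` arriving at the
edge: none on the path (`turnCount_toggle_zero`, the paths agree); one (`turnCount_toggle_one`: the cycle of the
other, inner and off the path by part II, is spliced in (`toggle_case1`) and turns by `4·turnSign β p`
(`loopTurn_eq'`), while the two turns at the edge flip); both (`turnCount_toggle_two`: the stretch between them is
excised and is the `β'`-cycle of `p₂`). The case split itself is `turnCount_toggle` of part IV.
-/

noncomputable section

namespace Summit.CriticalPhenomena.CardyFormulaZ2.Theorems.ParafermionFamiliesToSLESix.StripAnchored

open Function
open Literature.Probability.Percolation (BondConfig vcell fcell cornerDart lf_cornerDart rf_cornerDart orbitTrail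
  isTrail_orbitTrail mem_cdarts_orbitTrail_iff orbitTrail_eq_cornerOrbit cornerOrbit_ne_of_lt_minimalPeriod inv_orbitTrail)
open Literature.Probability.LatticeModels
open Literature.Probability.LatticeModels.DiscreteDobrushin (startCorner exitTime isStartCorner_startCorner
  isInnerFace_of_lt_exitTime not_isInnerFace_exitTime)
open Literature.Probability.LatticeModels.MedialTrail (wnd IsTrail cdarts)

namespace S5

variable {E : DiscreteDobrushin} {ω ω' : BondConfig (Site 2)} {c₀ p : Site 2 × Fin 4}

local notation "β" => E.bcBondConfig ω
local notation "β'" => E.bcBondConfig ω'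
local notation "orb" => cornerOrbit (E.bcBondConfig ω) c₀
local notation "orb'" => cornerOrbit (E.bcBondConfig ω') c₀

-- adapted from `S2.loopTurn_eq` (`…HalfCRVertexRelationLoop.lean`): `hx` replaced by `hi₁N' : i₁ + 1 < N`
/-- **Orientation of the cycle through the partner of a dart `q = orb i₁` (`i₁ + 1 < N`) of the path**: a cycle
of corners with inner faces avoiding the path's darts turns by `4 · turnSign β q`. [cite: Hopf1935, Satz I] -/
theorem loopTurn_eq' {βc : BondConfig (Site 2)} {q : Site 2 × Fin 4} {Q : ℕ}
    (hH : HoleFree {f : Site 2 | E.IsInnerFace f}) (hc₀ : E.IsStartCorner c₀) {N i₁ : ℕ}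
    (hQ0 : 0 < Q) (hQ : cornerOrbit βc (cornerPartner q) Q = cornerPartner q)
    (hQmin : ∀ s, 0 < s → s < Q → cornerOrbit βc (cornerPartner q) s ≠ cornerPartner q)
    (hLin : ∀ m, E.IsInnerFace (cFace (cornerOrbit βc (cornerPartner q) m)))
    (hdisj : ∀ m i, i < N → cornerOrbit βc (cornerPartner q) m ≠ cornerOrbit βc c₀ i)
    (hi₁ : cornerOrbit βc c₀ i₁ = q) (hi₁N' : i₁ + 1 < N) :
    ∑ m ∈ Finset.range Q, turnSign βc (cornerOrbit βc (cornerPartner q) m) = 4 * turnSign βc q := by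
  classical
  set q₂ := cornerPartner q with hq₂
  set l := List.map (fun m => cpos (cornerOrbit βc q₂ m)) (List.range Q)
  have hT : IsTrail l := S2.isTrail_loopTrail hQ0 hQ hQmin
  have ha : wnd l (vcell c₀.1) = 0 := by
    rw [S2.wnd_vcell_start_eq hc₀ hQ hT.2.2 hLin (fun m h => hdisj m 0 (by omega) h)]
    exact S2.wnd_fcell_eq_zero_of_not_isInnerFace hH hQ0 hQ hQmin hLin hc₀.isOutEdge.2
  have hsucc : cornerOrbit βc c₀ (i₁ + 1) = nextCorner βc q := by rw [← hi₁]; rfl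
  obtain ⟨hv1, hf1⟩ := S2.wnd_orbit_eq c₀ hQ hT.2.2 hdisj (i₁ + 1) hi₁N'
  rw [ha, hsucc] at hv1 hf1
  have hinv : (∑ m ∈ Finset.range Q, turnSign βc (cornerOrbit βc q₂ m) = 4 ∧ ∀ F, wnd l F = 0 ∨ wnd l F = 1) ∨
      (∑ m ∈ Finset.range Q, turnSign βc (cornerOrbit βc q₂ m) = -4 ∧ ∀ F, wnd l F = 0 ∨ wnd l F = -1) :=
    inv_cornerOrbit hQ0 hQ hQmin
  have hjump := hT.wnd_lf (S2.cornerDart_mem_cdarts hQ0 hQ)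
  rw [lf_cornerDart, rf_cornerDart] at hjump
  by_cases he : cTgt q ∈ βc
  · rw [turnSign_of_mem he]
    rw [nextCorner_of_mem he] at hv1
    have hv : wnd l (vcell q₂.1) = 0 := hv1
    rcases hinv with ⟨_, hw⟩ | ⟨hs, -⟩
    · exfalso; rcases hw (fcell (cFace q₂)) with h | h <;> omega
    · rw [hs]; norm_num
  · rw [turnSign_of_not_mem he]
    rw [cFace_nextCorner_of_not_mem he, ← S2.cFace_cornerPartner] at hf1
    have hf : wnd l (fcell (cFace q₂)) = 0 := hf1
    rcases hinv with ⟨hs, -⟩ | ⟨_, hw⟩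
    · rw [hs]; norm_num
    · exfalso; rcases hw (vcell q₂.1) with h | h <;> omega

-- adapted from `cornerOrbit_toggle_case1` (`InterfaceRearrangement.lean`), Steps A and D turned into hypotheses
/-- **Case 1 of the toggle, the loop being given**: `p = orb i₁` is a dart of the path, its partner is not, and
the partner's cycle (inner faces, off the path) is spliced in at `p`; exit at `N + Q`. [cite: Smirnov2010, Lemma 4.5] -/
theorem toggle_case1 (hE : E.IsZdAdmissible) (hc₀ : E.IsStartCorner c₀)
    (hagree : ∀ e, e ≠ cTgt p → (e ∈ β' ↔ e ∈ β)) (hdiff : ¬ (cTgt p ∈ β' ↔ cTgt p ∈ β))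
    {N Q i₁ : ℕ} (hN : ¬ E.IsInnerFace (cFace (orb N))) (hlt : ∀ k < N, E.IsInnerFace (cFace (orb k)))
    (hQ0 : 0 < Q) (hQ : cornerOrbit β (cornerPartner p) Q = cornerPartner p)
    (hQmin : ∀ s, 0 < s → s < Q → cornerOrbit β (cornerPartner p) s ≠ cornerPartner p)
    (hLin : ∀ m, E.IsInnerFace (cFace (cornerOrbit β (cornerPartner p) m)))
    (hdisj : ∀ m i, i < N → cornerOrbit β (cornerPartner p) m ≠ orb i)
    (hi₁ : orb i₁ = p) (hi₁N : i₁ < N) (h₂ : ∀ i < N, orb i ≠ cornerPartner p) :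
    (∀ i ≤ i₁, orb' i = orb i) ∧
    (∀ j, j + 1 ≤ Q → orb' (i₁ + 1 + j) = cornerOrbit β (cornerPartner p) (j + 1)) ∧
    (∀ j, i₁ + 1 + j ≤ N → orb' (i₁ + Q + 1 + j) = orb (i₁ + 1 + j)) ∧
    (∀ k < N + Q, E.IsInnerFace (cFace (orb' k))) ∧ ¬ E.IsInnerFace (cFace (orb' (N + Q))) := by
  set p₂ := cornerPartner p with hp₂
  have hinj : ∀ a, a < N → orb a = p → a = i₁ := by
    intro a ha h
    by_contra hne
    rcases Nat.lt_or_gt_of_ne hne with hab | hab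
    · exact cornerOrbit_ne hE hc₀ hab (fun k hk => hlt k (by omega)) (h.trans hi₁.symm)
    · exact cornerOrbit_ne hE hc₀ hab (fun k hk => hlt k (by omega)) (hi₁.trans h.symm)
  have hpre : ∀ i ≤ i₁, orb' i = orb i := by
    intro i hi
    induction i with
    | zero => rfl
    | succ i ih =>
      rw [cornerOrbit_succ, cornerOrbit_succ, ih (by omega)]
      refine nextCorner_toggle_of_ne hagree hdiff (fun h => ?_) (fun h => h₂ i (by omega) h)
      have := hinj i (by omega) h; omega
  have hloop : ∀ j, j + 1 ≤ Q → orb' (i₁ + 1 + j) = cornerOrbit β p₂ (j + 1) := by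
    intro j hj
    induction j with
    | zero =>
      rw [add_zero, cornerOrbit_succ, hpre i₁ le_rfl, hi₁, nextCorner_toggle hagree hdiff, Equiv.swap_apply_left]
      rfl
    | succ j ih =>
      rw [← add_assoc, cornerOrbit_succ, ih (by omega)]
      change nextCorner β' (cornerOrbit β p₂ (j + 1)) = nextCorner β (cornerOrbit β p₂ (j + 1))
      refine nextCorner_toggle_of_ne hagree hdiff (fun h => hdisj (j + 1) i₁ hi₁N (h.trans hi₁.symm)) ?_
      exact hQmin (j + 1) (Nat.succ_pos _) (by omega)
  have hback : orb' (i₁ + Q + 1) = orb (i₁ + 1) := by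
    have h1 : orb' (i₁ + Q) = p₂ := by
      have := hloop (Q - 1) (by omega)
      rwa [show i₁ + 1 + (Q - 1) = i₁ + Q by omega, Nat.sub_add_cancel hQ0, hQ] at this
    rw [cornerOrbit_succ, h1, nextCorner_toggle hagree hdiff, hp₂, Equiv.swap_apply_right, cornerOrbit_succ, hi₁]
  have htail : ∀ j, i₁ + 1 + j ≤ N → orb' (i₁ + Q + 1 + j) = orb (i₁ + 1 + j) := by
    intro j hj
    induction j with
    | zero => rw [add_zero, add_zero, hback]
    | succ j ih =>
      rw [← add_assoc, cornerOrbit_succ, ih (by omega), ← add_assoc, cornerOrbit_succ]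
      refine nextCorner_toggle_of_ne hagree hdiff (fun h => ?_) (fun h => h₂ _ (by omega) h)
      have := hinj _ (by omega) h; omega
  refine ⟨hpre, hloop, htail, fun k hk => ?_, ?_⟩
  · by_cases hk1 : k ≤ i₁
    · rw [hpre k hk1]; exact hlt k (by omega)
    · by_cases hk2 : k ≤ i₁ + Q
      · rw [show k = i₁ + 1 + (k - i₁ - 1) by omega, hloop _ (by omega)]; exact hLin _
      · rw [show k = i₁ + Q + 1 + (k - i₁ - Q - 1) by omega, htail _ (by omega)]; exact hlt _ (by omega)
  · have := htail (N - i₁ - 1) (by omega)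
    rw [show i₁ + Q + 1 + (N - i₁ - 1) = N + Q by omega, show i₁ + 1 + (N - i₁ - 1) = N by omega] at this
    rwa [this]

/-! ## The toggle invariance of turn counts -/

section One

variable (hE : E.IsZdAdmissible)

local notation "sorb" => cornerOrbit (E.bcBondConfig ω) (startCorner hE)
local notation "sorb'" => cornerOrbit (E.bcBondConfig ω') (startCorner hE)

/-- Darts of a cut orbit with inner faces are pairwise distinct (index form). [cite: Smirnov2001, §2] -/
theorem orbit_inj {ωc : BondConfig (Site 2)} {M : ℕ}
    (hlt : ∀ k < M, E.IsInnerFace (cFace (cornerOrbit (E.bcBondConfig ωc) (startCorner hE) k))) {a b : ℕ}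
    (ha : a < M) (hb : b < M) (h : cornerOrbit (E.bcBondConfig ωc) (startCorner hE) a =
      cornerOrbit (E.bcBondConfig ωc) (startCorner hE) b) : a = b := by
  by_contra hne
  rcases Nat.lt_or_gt_of_ne hne with hab | hab
  · exact cornerOrbit_ne hE (isStartCorner_startCorner hE) hab (fun k hk => hlt k (by omega)) h
  · exact cornerOrbit_ne hE (isStartCorner_startCorner hE) hab (fun k hk => hlt k (by omega)) h.symm

omit hE in
/-- The turn at `p` flips under the toggle. [folklore] -/
theorem turnSign_toggle (hdiff : ¬ (cTgt p ∈ β' ↔ cTgt p ∈ β)) : turnSign β' p = -turnSign β p := by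
  by_cases he : cTgt p ∈ β
  · rw [turnSign_of_mem he, turnSign_of_not_mem (fun h => hdiff ⟨fun _ => he, fun _ => h⟩)]; norm_num
  · rw [turnSign_of_not_mem he, turnSign_of_mem (by by_contra h; exact hdiff ⟨fun h' => absurd h' h, fun h' => absurd h' he⟩)]

omit hE in
/-- **Equal stretches have equal turn-count increments.** [cite: Smirnov2010, §4] -/
theorem turnCount_sub_eq {β₁ β₂ : BondConfig (Site 2)} {c : Site 2 × Fin 4} {a₁ a₂ n : ℕ}
    (horb : ∀ m < n, cornerOrbit β₁ c (a₁ + m) = cornerOrbit β₂ c (a₂ + m))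
    (htgt : ∀ m < n, (cTgt (cornerOrbit β₂ c (a₂ + m)) ∈ β₁ ↔ cTgt (cornerOrbit β₂ c (a₂ + m)) ∈ β₂)) :
    turnCount β₁ c (a₁ + n) - turnCount β₁ c a₁ = turnCount β₂ c (a₂ + n) - turnCount β₂ c a₂ := by
  rw [turnCount_add, turnCount_add, add_sub_cancel_left, add_sub_cancel_left]
  exact Finset.sum_congr rfl fun m hm => by
    rw [Finset.mem_range] at hm; rw [horb m hm]; exact turnSign_congr (htgt m hm)

/-- **Toggle invariance, one dart on the edge** (`p = orb i₁` on the path, its partner not): every common dart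
`c = orb i = orb' i'` has the same turn count in both. [cite: Smirnov2010, proof of Lemma 4.5] -/
theorem turnCount_toggle_one (hH : HoleFree {f : Site 2 | E.IsInnerFace f})
    (hagree : ∀ e, e ≠ cTgt p → (e ∈ β' ↔ e ∈ β)) (hdiff : ¬ (cTgt p ∈ β' ↔ cTgt p ∈ β))
    (hB : ∀ x ∈ cTgt p, x ∉ E.zdArcB) {i₁ : ℕ} (hi₁ : sorb i₁ = p) (hi₁N : i₁ < exitTime hE ω)
    (h₂ : ∀ i < exitTime hE ω, sorb i ≠ cornerPartner p)
    {c : Site 2 × Fin 4} {i i' : ℕ} (hi : i < exitTime hE ω) (hi' : i' < exitTime hE ω')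
    (hci : sorb i = c) (hci' : sorb' i' = c) : turnCount β (startCorner hE) i = turnCount β' (startCorner hE) i' := by
  set N := exitTime hE ω
  have hc₀ := isStartCorner_startCorner hE
  have hN : ¬ E.IsInnerFace (cFace (sorb N)) := not_isInnerFace_exitTime hE ω
  have hlt : ∀ k < N, E.IsInnerFace (cFace (sorb k)) := fun k hk => isInnerFace_of_lt_exitTime hE ω hk
  set p₂ := cornerPartner p with hp₂
  -- the partner has an inner face: otherwise `e` would be a face-boundary edge between `A`-sites, open in both
  have hpin : E.IsInnerFace (cFace p) := hi₁ ▸ hlt i₁ hi₁N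
  have hp₂in : E.IsInnerFace (cFace p₂) := by
    by_contra hout
    rw [hp₂, S2.cFace_cornerPartner] at hout
    have hfb : E.IsFaceBoundaryEdge p.1 (p.1 + cornerUnit (p.2 + 1)) :=
      ⟨DiscreteDobrushin.adj_of_isInnerFace_faceAt (by rw [fin4_add_one_add_three]; exact hpin) (Or.inr rfl),
        ⟨_, hpin, isCorner_faceAt _ _, (isCorner_add_faceAt_iff _ _ _).2 (Or.inr (fin4_add_one_add_three p.2).symm)⟩,
        ⟨_, hout, isCorner_faceAt _ _, (isCorner_add_faceAt_iff _ _ _).2 (Or.inl rfl)⟩⟩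
    obtain ⟨h1, h2⟩ := hE.arcs_cover_faceBoundary hfb
    have hA : ∀ x ∈ cTgt p, x ∈ E.zdArcA := fun x hx => by
      rcases Sym2.mem_iff.1 hx with rfl | rfl
      · exact h1.resolve_right (hB _ (Sym2.mem_mk_left _ _))
      · exact h2.resolve_right (hB _ (Sym2.mem_mk_right _ _))
    exact hdiff ⟨fun _ => DiscreteDobrushin.mem_bcBondConfig_of_arcA hfb.1 hA,
      fun _ => DiscreteDobrushin.mem_bcBondConfig_of_arcA hfb.1 hA⟩
  have hnB : p₂.1 ∉ E.zdArcB := hB _ (by rw [← cTgt_partner p]; exact Sym2.mem_mk_left _ _)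
  have hper := mem_periodicPts_of_off hE hp₂in hnB h₂
  set Q := minimalPeriod (nextCorner β) p₂ with hQdef
  have hQ0 : 0 < Q := minimalPeriod_pos_of_mem_periodicPts hper
  have hQ : cornerOrbit β p₂ Q = p₂ := by rw [cornerOrbit_eq_iterate]; exact iterate_minimalPeriod
  have hQmin := cornerOrbit_ne_of_lt_minimalPeriod hper
  have hLin : ∀ m, E.IsInnerFace (cFace (cornerOrbit β p₂ m)) := fun m => by
    rw [cornerOrbit_eq_iterate]; exact isInnerFace_iterate hE hp₂in hnB h₂ m
  have hdisj : ∀ m i, i < N → cornerOrbit β p₂ m ≠ sorb i := by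
    intro m i hiN h
    have key : cornerOrbit β p₂ ((N - i) + m) = sorb N := by
      rw [cornerOrbit_eq_iterate, iterate_add_apply, ← cornerOrbit_eq_iterate _ p₂ m, h, cornerOrbit_eq_iterate,
        cornerOrbit_eq_iterate, ← iterate_add_apply, Nat.sub_add_cancel hiN.le]
    exact hN (key ▸ hLin _)
  obtain ⟨hpre, hloop, htail, hlt', hN'⟩ := toggle_case1 hE hc₀ hagree hdiff hN hlt hQ0 hQ hQmin hLin hdisj hi₁ hi₁N h₂
  rw [exitTime_eq_of hE ω' hN' hlt'] at hi'
  have htgt : ∀ j < N, j ≠ i₁ → cTgt (sorb j) ≠ cTgt p := by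
    intro j hj h1 h
    rcases cTgt_eq_cTgt_iff.1 h with h | h
    · exact h1 (orbit_inj hE hlt hj hi₁N (h.trans hi₁.symm))
    · exact h₂ j hj h
  by_cases hle : i ≤ i₁
  · -- before the toggled edge: same darts, same targets
    obtain rfl : i' = i := orbit_inj hE hlt' hi' (by omega) (hci'.trans (hci.symm.trans (hpre i hle).symm))
    exact (turnCount_congr_prefix (fun j hj => hpre j (hj.trans hle))
      (fun j hj => hagree _ (htgt j (by omega) (by omega)))).symm
  · -- after it: `c = orb' (i + Q)`, and the turn count at time `i₁ + Q + 1` is that at time `i₁ + 1`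
    push Not at hle
    have hshift : ∀ m, m < N - i₁ - 1 → sorb' (i₁ + Q + 1 + m) = sorb (i₁ + 1 + m) := fun m hm => htail m (by omega)
    have hci'' : sorb' (i + Q) = c := by
      rw [show i + Q = i₁ + Q + 1 + (i - i₁ - 1) by omega, hshift _ (by omega), show i₁ + 1 + (i - i₁ - 1) = i by omega, hci]
    obtain rfl : i' = i + Q := orbit_inj hE hlt' hi' (by omega) (hci'.trans hci''.symm)
    have hS := loopTurn_eq' hH hc₀ hQ0 hQ hQmin hLin hdisj hi₁ (show i₁ + 1 < N by omega)
    have hC' : turnCount β' (startCorner hE) i₁ = turnCount β (startCorner hE) i₁ :=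
      turnCount_congr_prefix hpre fun j hj => hagree _ (htgt j (by omega) (by omega))
    have hS1 : ∑ m ∈ Finset.range (Q - 1), turnSign β (cornerOrbit β p₂ (m + 1)) = 3 * turnSign β p := by
      have h := hS
      rw [show Q = (Q - 1) + 1 by omega, Finset.sum_range_succ', cornerOrbit_zero, S2.turnSign_partner] at h
      linear_combination h
    have hloopQ : sorb' (i₁ + Q) = p₂ := by
      have := hloop (Q - 1) (by omega)
      rwa [show i₁ + 1 + (Q - 1) = i₁ + Q by omega, Nat.sub_add_cancel hQ0, hQ] at this
    have hkey : turnCount β' (startCorner hE) (i₁ + Q + 1) = turnCount β (startCorner hE) (i₁ + 1) := by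
      rw [turnCount_succ, hloopQ, S2.turnSign_partner, turnCount_add, show Q = (Q - 1) + 1 by omega,
        Finset.sum_range_succ', add_zero, hpre i₁ le_rfl, hi₁, hC', turnCount_succ, hi₁, turnSign_toggle hdiff]
      have hterm : ∀ m ∈ Finset.range (Q - 1), turnSign β' (sorb' (i₁ + (m + 1))) = turnSign β (cornerOrbit β p₂ (m + 1)) := by
        intro m hm
        rw [Finset.mem_range] at hm
        rw [show i₁ + (m + 1) = i₁ + 1 + m by omega, hloop m (by omega)]
        refine turnSign_congr (hagree _ fun h => ?_)
        rcases cTgt_eq_cTgt_iff.1 h with h | h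
        · exact hdisj (m + 1) i₁ hi₁N (h.trans hi₁.symm)
        · exact hQmin (m + 1) (Nat.succ_pos _) (by omega) h
      rw [Finset.sum_congr rfl hterm, hS1]; ring
    have hinc := turnCount_sub_eq (β₁ := β') (β₂ := β) (c := startCorner hE) (a₁ := i₁ + Q + 1) (a₂ := i₁ + 1)
      (n := i - i₁ - 1) (fun m hm => hshift m (by omega)) (fun m hm => hagree _ (htgt _ (by omega) (by omega)))
    rw [show i₁ + Q + 1 + (i - i₁ - 1) = i + Q by omega, show i₁ + 1 + (i - i₁ - 1) = i by omega, hkey] at hinc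
    linarith

/-- **Toggle invariance, no dart on the edge**: if neither corner arriving at `e` is a dart of the path of
`ω`, the two paths and their turn counts agree. [cite: Smirnov2010, proof of Lemma 4.5] -/
theorem turnCount_toggle_zero
    (hagree : ∀ e, e ≠ cTgt p → (e ∈ β' ↔ e ∈ β)) (hdiff : ¬ (cTgt p ∈ β' ↔ cTgt p ∈ β))
    (h₁ : ∀ i < exitTime hE ω, sorb i ≠ p) (h₂ : ∀ i < exitTime hE ω, sorb i ≠ cornerPartner p)
    {c : Site 2 × Fin 4} {i i' : ℕ} (hi : i < exitTime hE ω) (hi' : i' < exitTime hE ω')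
    (hci : sorb i = c) (hci' : sorb' i' = c) : turnCount β (startCorner hE) i = turnCount β' (startCorner hE) i' := by
  set N := exitTime hE ω
  have hsame := cornerOrbit_toggle_case0 (c₀ := startCorner hE) hagree hdiff h₁ h₂
  have hlt' : ∀ k < N, E.IsInnerFace (cFace (sorb' k)) := fun k hk => by
    rw [hsame k hk.le]; exact isInnerFace_of_lt_exitTime hE ω hk
  rw [exitTime_eq_of hE ω' (by rw [hsame N le_rfl]; exact not_isInnerFace_exitTime hE ω) hlt'] at hi'
  obtain rfl : i' = i := orbit_inj hE hlt' hi' hi (by rw [hci', hsame i hi.le, hci])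
  refine (turnCount_congr_prefix (fun j hj => hsame j (by omega)) fun j hj => hagree _ fun h => ?_).symm
  rcases cTgt_eq_cTgt_iff.1 h with h | h
  · exact h₁ j (by omega) h
  · exact h₂ j (by omega) h

/-- **Toggle invariance, both darts on the edge** (`p = orb i₁`, `cornerPartner p = orb i₂`, `i₁ < i₂`): the
excised stretch is a `β'`-cycle turning by `4 · turnSign β' p`. [cite: Smirnov2010, proof of Lemma 4.5] -/
theorem turnCount_toggle_two (hH : HoleFree {f : Site 2 | E.IsInnerFace f})
    (hagree : ∀ e, e ≠ cTgt p → (e ∈ β' ↔ e ∈ β)) (hdiff : ¬ (cTgt p ∈ β' ↔ cTgt p ∈ β))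
    {i₁ i₂ : ℕ} (hi₁ : sorb i₁ = p) (hi₂ : sorb i₂ = cornerPartner p) (h12 : i₁ < i₂) (hi₂N : i₂ < exitTime hE ω)
    {c : Site 2 × Fin 4} {i i' : ℕ} (hi : i < exitTime hE ω) (hi' : i' < exitTime hE ω')
    (hci : sorb i = c) (hci' : sorb' i' = c) : turnCount β (startCorner hE) i = turnCount β' (startCorner hE) i' := by
  set N := exitTime hE ω
  have hc₀ := isStartCorner_startCorner hE
  have hN : ¬ E.IsInnerFace (cFace (sorb N)) := not_isInnerFace_exitTime hE ω
  have hlt : ∀ k < N, E.IsInnerFace (cFace (sorb k)) := fun k hk => isInnerFace_of_lt_exitTime hE ω hk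
  set p₂ := cornerPartner p with hp₂
  obtain ⟨hpre, htail⟩ := cornerOrbit_toggle_case2 hE hc₀ hagree hdiff hlt hi₁ hi₂ h12 hi₂N
  obtain ⟨hout', hin'⟩ := exit_toggle_case2 hE hc₀ hagree hdiff hN hlt hi₁ hi₂ h12 hi₂N
  rw [exitTime_eq_of hE ω' hout' hin'] at hi'
  have htgt : ∀ j < N, j ≠ i₁ → j ≠ i₂ → cTgt (sorb j) ≠ cTgt p := by
    intro j hj h1 h2 h
    rcases cTgt_eq_cTgt_iff.1 h with h | h
    · exact h1 (orbit_inj hE hlt hj (by omega) (h.trans hi₁.symm))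
    · exact h2 (orbit_inj hE hlt hj hi₂N (h.trans hi₂.symm))
  rcases le_or_gt i' i₁ with hle | hgt
  · -- prefix
    obtain rfl : i = i' := orbit_inj hE hlt hi (by omega) (hci.trans (hci'.symm.trans (hpre i' hle)))
    exact (turnCount_congr_prefix (fun j hj => hpre j (hj.trans hle))
      (fun j hj => hagree _ (htgt j (by omega) (by omega) (by omega)))).symm
  · -- shifted suffix: `c = orb' i' = orb (i' + (i₂ - i₁))`
    have hshift : ∀ m, m < N - i₂ - 1 → sorb' (i₁ + 1 + m) = sorb (i₂ + 1 + m) := fun m hm => htail m (by omega)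
    have hii : i = i' + (i₂ - i₁) := orbit_inj hE hlt hi (by omega) (by
      rw [hci, ← hci', show i' = i₁ + 1 + (i' - i₁ - 1) by omega, hshift _ (by omega)]; congr 1; omega)
    subst hii
    set Q := i₂ - i₁ with hQdef
    have hQ0 : 0 < Q := by omega
    have hCs' : ∀ s, s ≤ Q → 0 < s → cornerOrbit β' p₂ s = sorb (i₁ + s) := by
      intro s hsQ hs
      induction s with
      | zero => omega
      | succ s ih =>
        rcases Nat.eq_zero_or_pos s with rfl | hs0
        · rw [cornerOrbit_succ, cornerOrbit_zero, nextCorner_toggle hagree hdiff, hp₂, Equiv.swap_apply_right, ← hi₁,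
            ← cornerOrbit_succ]
        · rw [cornerOrbit_succ, ih (by omega) hs0, nextCorner_toggle_of_ne hagree hdiff, ← cornerOrbit_succ]
          · exact congrArg _ (by omega)
          · intro h; have := orbit_inj hE hlt (show i₁ + s < N by omega) (by omega) (h.trans hi₁.symm); omega
          · intro h; have := orbit_inj hE hlt (show i₁ + s < N by omega) hi₂N (h.trans hi₂.symm); omega
    have hQ : cornerOrbit β' p₂ Q = p₂ := by rw [hCs' Q le_rfl hQ0, show i₁ + Q = i₂ by omega, hi₂]
    have hCs : ∀ s, 0 < s → s < Q → cornerOrbit β' p₂ s = sorb (i₁ + s) := fun s hs hsQ => hCs' s hsQ.le hs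
    have hQmin : ∀ s, 0 < s → s < Q → cornerOrbit β' p₂ s ≠ p₂ := by
      intro s hs hsQ h
      rw [hCs s hs hsQ] at h
      have := orbit_inj hE hlt (show i₁ + s < N by omega) hi₂N (h.trans hi₂.symm); omega
    have hfix : IsPeriodicPt (nextCorner β') Q p₂ := by
      show (nextCorner β')^[Q] p₂ = p₂
      rw [← cornerOrbit_eq_iterate]; exact hQ
    have hCm : ∀ m, cornerOrbit β' p₂ m = p₂ ∨ ∃ s, 0 < s ∧ s < Q ∧ cornerOrbit β' p₂ m = sorb (i₁ + s) := fun m => by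
      rw [cornerOrbit_eq_iterate, ← hfix.iterate_mod_apply, ← cornerOrbit_eq_iterate]
      rcases Nat.eq_zero_or_pos (m % Q) with h0 | hpos
      · left; rw [h0, cornerOrbit_zero]
      · right; exact ⟨m % Q, hpos, Nat.mod_lt m hQ0, hCs _ hpos (Nat.mod_lt m hQ0)⟩
    have hLin : ∀ m, E.IsInnerFace (cFace (cornerOrbit β' p₂ m)) := fun m => by
      rcases hCm m with h | ⟨s, -, hsQ, h⟩ <;> rw [h]
      · rw [← hi₂]; exact hlt i₂ hi₂N
      · exact hlt _ (by omega)
    have hdisj : ∀ m k, k < N - (i₂ - i₁) → cornerOrbit β' p₂ m ≠ sorb' k := by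
      intro m k hk h
      have hk' : sorb' k = sorb (if k ≤ i₁ then k else k + Q) := by
        split_ifs with hk1
        · exact hpre k hk1
        · rw [show k = i₁ + 1 + (k - i₁ - 1) by omega, hshift _ (by omega)]; congr 1; omega
      rw [hk'] at h
      rcases hCm m with hm | ⟨s, hs0, hsQ, hm⟩ <;> rw [hm] at h
      · rw [← hi₂] at h
        have := orbit_inj hE hlt hi₂N (by split_ifs <;> omega) h
        split_ifs at this <;> omega
      · have := orbit_inj hE hlt (show i₁ + s < N by omega) (by split_ifs <;> omega) h
        split_ifs at this <;> omega
    have hi₁' : sorb' i₁ = p := by rw [hpre i₁ le_rfl, hi₁]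
    have hS := loopTurn_eq' (βc := β') hH hc₀ (N := N - (i₂ - i₁)) hQ0 hQ hQmin hLin hdisj hi₁' (by omega)
    have hC' : turnCount β' (startCorner hE) i₁ = turnCount β (startCorner hE) i₁ :=
      turnCount_congr_prefix hpre fun j hj => hagree _ (htgt j (by omega) (by omega) (by omega))
    have hmid : ∑ m ∈ Finset.range (Q - 1), turnSign β (sorb (i₁ + 1 + m)) = -3 * turnSign β p := by
      have h := hS
      rw [show Q = (Q - 1) + 1 by omega, Finset.sum_range_succ', cornerOrbit_zero, S2.turnSign_partner,
        turnSign_toggle hdiff] at h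
      have hterm : ∀ m ∈ Finset.range (Q - 1), turnSign β' (cornerOrbit β' p₂ (m + 1)) = turnSign β (sorb (i₁ + 1 + m)) := by
        intro m hm
        rw [Finset.mem_range] at hm
        rw [hCs (m + 1) (Nat.succ_pos _) (by omega), show i₁ + (m + 1) = i₁ + 1 + m by omega]
        exact turnSign_congr (hagree _ (htgt _ (by omega) (by omega) (by omega)))
      rw [Finset.sum_congr rfl hterm] at h
      linear_combination h
    have hkey : turnCount β' (startCorner hE) (i₁ + 1) = turnCount β (startCorner hE) (i₂ + 1) := by
      have t3 : turnCount β (startCorner hE) i₂ = turnCount β (startCorner hE) (i₁ + 1) +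
          ∑ m ∈ Finset.range (Q - 1), turnSign β (sorb (i₁ + 1 + m)) := by
        have := turnCount_add β (startCorner hE) (i₁ + 1) (Q - 1)
        rwa [show i₁ + 1 + (Q - 1) = i₂ by omega] at this
      rw [turnCount_succ, hi₁', hC', turnSign_toggle hdiff, turnCount_succ, hi₂, S2.turnSign_partner, t3, hmid,
        turnCount_succ, hi₁]
      ring
    have hinc := turnCount_sub_eq (β₁ := β') (β₂ := β) (c := startCorner hE) (a₁ := i₁ + 1) (a₂ := i₂ + 1)
      (n := i' - i₁ - 1) (fun m hm => hshift m (by omega)) (fun m hm => hagree _ (htgt _ (by omega) (by omega) (by omega)))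
    rw [show i₁ + 1 + (i' - i₁ - 1) = i' by omega, show i₂ + 1 + (i' - i₁ - 1) = i' + (i₂ - i₁) by omega, hkey] at hinc
    linarith

end One

end S5

/-- **Registered one-line form `stub_anchor_toggle`** of `S5.turnSign_toggle` (helper of stub S5
`stub_anchoredWallFlux`): toggling the edge ahead of a corner flips its turn sign. [folklore] -/
theorem stub_anchor_toggle : ∀ (E : DiscreteDobrushin) (ω ω' : BondConfig (Site 2)) (p : Site 2 × Fin 4), ¬ (cTgt p ∈ E.bcBondConfig ω' ↔ cTgt p ∈ E.bcBondConfig ω) → turnSign (E.bcBondConfig ω') p = -turnSign (E.bcBondConfig ω) p :=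
  fun _ _ _ _ h => S5.turnSign_toggle h

end Summit.CriticalPhenomena.CardyFormulaZ2.Theorems.ParafermionFamiliesToSLESix.StripAnchored

end
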